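import Literature.Barriers.QuantumAdvantage.FFKLGenericCollapse
import Literature.Computability.Complexity.OracleRunPolynomials
import Literature.Computability.Complexity.ApproxDegreeCertificates
import Mathlib.Data.Set.Finite.List
import Mathlib.Data.Set.Card
import HarnessLib

/-!
# `AWPP^{B ⊕ ·}` descriptions have polynomial certificate complexity (Fenner–Fortnow–Kurtz–Li, Thm. 6.13, rerelativized)

Support file for the named fact
`Literature.Barriers.QuantumAdvantage.fennerFortnowKurtzLi2003_thm618_awpp`
(`FortnowRogersOracle.lean`; reduced in `FFKLGenericCollapse.lean` to the Standard-Algorithm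
statement for categorical descriptions `AWPPDescr`). Fenner–Fortnow–Kurtz–Li, *An oracle
builder's toolkit*, Inform. and Comput. 182 (2003), **Thm. 6.13** (pp. 31–32): "AWPP has
polynomial certificate complexity" — proof: fix a machine categorical over `σ` and an input `x`
of length `n`; over the oracle bits `y` extending `σ` the value `M^y(x)` is a Boolean function
`f(y)`, the gap `h(y)` is an integer polynomial of degree `≤ nᵏ` (Lemma 6.12) with
`|f(y) - h(y)/2^{q(n)}| ≤ 1/3` by the `AWPP` promise, so Thm. 6.11 (Nisan–Szegedy) bounds the
certificate complexity of `f` by `c(nᵏ)`, "a polynomial independent of `σ`".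

This file carries the printed proof out for the descriptions `Δ : AWPPDescr` of
`FFKLGenericCollapse.lean` (two counting machines run against `B ⊕ Z`, witness lengths, gap
exponent; `Δ.Categorical B σ`: the promise holds at every input for every `Z` extending `σ`),
gluing the tree's Lemma 6.12 (`OracleAlg.gapPoly`, `OracleRunPolynomials.lean`: degree `≤` fuel
under a *view* presenting each oracle bit as a window variable or a constant) to the tree's
Thm. 6.11 (`blockSensitivity_le_four_mul_sq_of_approx`, `exists_certificate_of_approx`,
`ApproxDegreeCertificates.lean`: a `[0,1]`-valued approximant of degree `≤ d` gives
`bs(f) ≤ 4d²`, `C(f) ≤ 16d⁴`):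

* `AWPPDescr.certDeg Δ x = max (q₁(|⟨x,y₁⟩|)) (q₂(|⟨x,y₂⟩|))` — the common fuel of the two machines
  on the witnesses of `x` (the degree bound `d(x)`), dominated by the polynomial `certDegPoly`;
* `AWPPDescr.certWindow Δ σ x` — the WINDOW: the strings of length `< d(x)` outside `dom σ` (the
  only strings of `Z` the two machines can read on the witnesses of `x`, by well-formedness),
  numbered by `Finset.equivFin`; `certOracle σ x u` — the oracle of a window point `u` (`σ`'s
  true strings and the window strings `u` makes true; it extends `σ`); `certPoint σ x Z` — the
  window point of an oracle; `certFn B σ x` — the Boolean function `u ↦ [x ∈ lang B (certOracle u)]`;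
* `AWPPDescr.certView B σ x` — the view of the join `B ⊕ Z` over the window (`ε ↦ 0`,
  `0w ↦ [w ∈ B]`, `1w ↦` the variable of `w` on the window, `σ(w)` / `0` off it), with
  `viewOracle_certView`: at the window point `u` it presents exactly `B ⊕ certOracle u`;
  `certPoly B σ x = gapPoly/2^{p(|x|)}`, of total degree `≤ d(x)` (`totalDegree_certPoly_le`)
  and evaluating to `gap/2^{p(|x|)}` (`eval_certPoly`);
* PROVED, Thm. 6.13: for `Δ` categorical over `σ`, `blockSensitivity (certFn) ≤ 4 d(x)²`
  (`blockSensitivity_certFn_le`), `certificateComplexity (certFn) ≤ 16 d(x)⁴`, a certificate of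
  at most `16 d(x)⁴` window variables at every point (`exists_isCertificate_certFn`); and, for
  WELL-FORMED `Δ`, the transfer to oracles: `mem_lang_iff_certFn` (`x ∈ lang B Z ↔
  certFn (certPoint Z) = 1` for `Z` extending `σ`, by the locality `gap_congr`) and the printed
  form `exists_certificate_condition` — every `Z` extending `σ` carries a finite condition `β`
  (a restriction of `Z` to at most `16 d(x)⁴` window strings, each of length `< d(x)`) deciding
  `x ∈ lang B Z'` for every `Z'` extending `σ` and `β` ("the certificate complexity of `M(x)` over
  `σ` is bounded by `c(nᵏ)(1 + nᵏ)`, a polynomial independent of `σ`").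

These are the two inputs the Standard Algorithm needs from Thm. 6.13: the round bound
`R ≥ bs(f)` of `StdAlg.decide_eq` (`StandardAlgorithm.lean`) and the size bound of the
certificates it queries.

## References

* [FennerFortnowKurtzLi2003IC] Lemma 6.12, Thm. 6.13 (pp. 31–32), Def. 6.6/6.7 (p. 27), read via
  `lit read doi:10.1016/s0890-5401(03)00018-x --pages 25-34`.
* [BealsEtAl2001] Thm. 4.13 (proof), Lemma 5.2 (the tree's `ApproxDegreeCertificates.lean`).
* N. Nisan, M. Szegedy, Comput. Complexity 4 (1994) (Thm. 6.11).
-/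

noncomputable section

namespace Literature.Barriers.QuantumAdvantage

open _root_.Computability Literature.Computability.Complexity Literature.Computability.Complexity.Classes
  Literature.Computability.Complexity.CohenCondition Literature.Computability.QuantumComplexity Finset

namespace AWPPDescr

variable (Δ : AWPPDescr) (B : Language Bool)

/-! ### Fuels on the witnesses of an input, and the degree bound -/

/-- The fuel of `M₁` on the witnesses `⟨x, y⟩`, `|y| = r₁(|x|)`: `q₁(2|x| + 2 + r₁(|x|))`.
[cite: FennerFortnowKurtzLi2003IC, Lemma 6.12 (p. 31)] -/
def certFuel₁ (x : List Bool) : ℕ :=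
  Δ.q₁.eval (2 * x.length + 2 + Δ.r₁.eval x.length)

/-- The fuel of `M₂` on the witnesses `⟨x, y⟩`, `|y| = r₂(|x|)`. [cite: FennerFortnowKurtzLi2003IC, Lemma 6.12 (p. 31)] -/
def certFuel₂ (x : List Bool) : ℕ :=
  Δ.q₂.eval (2 * x.length + 2 + Δ.r₂.eval x.length)

/-- **The degree bound `d(x)`**: the larger of the two fuels (the gap at `x` is a polynomial of
total degree `≤ d(x)` in the oracle bits). [cite: FennerFortnowKurtzLi2003IC, Lemma 6.12 and Thm. 6.13 (pp. 31–32)] -/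
def certDeg (x : List Bool) : ℕ :=
  max (Δ.certFuel₁ x) (Δ.certFuel₂ x)

/-- A polynomial dominating `d(x)`: `q₁ ∘ (2X + 2 + r₁) + q₂ ∘ (2X + 2 + r₂)`. [cite: FennerFortnowKurtzLi2003IC, Thm. 6.13 (p. 32, "a polynomial independent of σ")] -/
def certDegPoly : Polynomial ℕ :=
  Δ.q₁.comp (2 * Polynomial.X + 2 + Δ.r₁) + Δ.q₂.comp (2 * Polynomial.X + 2 + Δ.r₂)

/-- The fuel of `M₁` is the same on all witnesses of `x`. [folklore] -/
theorem eval_length_boolPair_eq_certFuel₁ (x : List Bool) (y : List.Vector Bool (Δ.r₁.eval x.length)) :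
    Δ.q₁.eval (boolPair x y.toList).length = Δ.certFuel₁ x := by
  rw [length_boolPair, List.Vector.toList_length]
  rfl

/-- The fuel of `M₂` is the same on all witnesses of `x`. [folklore] -/
theorem eval_length_boolPair_eq_certFuel₂ (x : List Bool) (y : List.Vector Bool (Δ.r₂.eval x.length)) :
    Δ.q₂.eval (boolPair x y.toList).length = Δ.certFuel₂ x := by
  rw [length_boolPair, List.Vector.toList_length]
  rfl

/-- `d(x) ≤ certDegPoly(|x|)`: the degree bound is polynomial in `|x|`. [cite: FennerFortnowKurtzLi2003IC, Thm. 6.13 (p. 32)] -/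
theorem certDeg_le_eval_certDegPoly (x : List Bool) : Δ.certDeg x ≤ Δ.certDegPoly.eval x.length := by
  have h₁ : Δ.certFuel₁ x = (Δ.q₁.comp (2 * Polynomial.X + 2 + Δ.r₁)).eval x.length := by
    simp [certFuel₁, Polynomial.eval_comp]
  have h₂ : Δ.certFuel₂ x = (Δ.q₂.comp (2 * Polynomial.X + 2 + Δ.r₂)).eval x.length := by
    simp [certFuel₂, Polynomial.eval_comp]
  unfold certDeg certDegPoly
  rw [Polynomial.eval_add, ← h₁, ← h₂]
  exact max_le (Nat.le_add_right _ _) (Nat.le_add_left _ _)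

/-! ### The window of an input over a condition -/

/-- **The window** of the input `x` over the condition `σ`: the strings of length `< d(x)` not
decided by `σ` — the oracle bits "`y` extending `σ`" of the printed proof that the machines can
actually read on the witnesses of `x`. [cite: FennerFortnowKurtzLi2003IC, Thm. 6.13 (proof, pp. 31–32)] -/
def certWindow (σ : CohenCondition) (x : List Bool) : Finset (List Bool) := by
  classical
  exact (List.finite_length_lt Bool (Δ.certDeg x)).toFinset.filter fun w => w ∉ σ.dom

variable {Δ} in
/-- Membership in the window. [folklore] -/
theorem mem_certWindow {σ : CohenCondition} {x w : List Bool} :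
    w ∈ Δ.certWindow σ x ↔ w.length < Δ.certDeg x ∧ w ∉ σ.dom := by
  classical
  unfold certWindow
  simp only [Finset.mem_filter, Set.Finite.mem_toFinset, Set.mem_setOf_eq]

/-- **The oracle of a window point** `u`: the strings `σ` makes true together with the window
strings `u` makes true (everything else false). [cite: FennerFortnowKurtzLi2003IC, Thm. 6.13 (proof, p. 32: "let y be induced by any oracle A")] -/
def certOracle (σ : CohenCondition) (x : List Bool) (u : Fin (Δ.certWindow σ x).card → Bool) :
    Language Bool :=
  {w | σ.val w = some true ∨ ∃ h : w ∈ Δ.certWindow σ x, u ((Δ.certWindow σ x).equivFin ⟨w, h⟩) = true}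

/-- **The window point of an oracle** `Z`: its bits on the window. [cite: FennerFortnowKurtzLi2003IC, Thm. 6.13 (proof, p. 32)] -/
def certPoint (σ : CohenCondition) (x : List Bool) (Z : Language Bool) :
    Fin (Δ.certWindow σ x).card → Bool :=
  fun i => Z.boolIndicator ((Δ.certWindow σ x).equivFin.symm i).1

/-- **The Boolean function of `x` on the window**: `f(u) = [x ∈ lang B (certOracle u)]` ("define the
function `f(y)` to be `1` when `M^y(x)` accepts and `0` when `M^y(x)` rejects").
[cite: FennerFortnowKurtzLi2003IC, Thm. 6.13 (proof, p. 31)] -/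
def certFn (σ : CohenCondition) (x : List Bool) (u : Fin (Δ.certWindow σ x).card → Bool) : Bool :=
  (Δ.lang B (Δ.certOracle σ x u)).boolIndicator x

variable {Δ B}

/-- The oracle of a window point extends `σ`. [cite: FennerFortnowKurtzLi2003IC, Thm. 6.13 (proof, p. 31: "y extending σ")] -/
theorem extendedBy_certOracle (σ : CohenCondition) (x : List Bool)
    (u : Fin (Δ.certWindow σ x).card → Bool) : σ.ExtendedBy (Δ.certOracle σ x u) := by
  intro q b hq
  have hqdom : q ∈ σ.dom := by rw [mem_dom_iff, hq]; exact Option.some_ne_none b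
  change (σ.val q = some true ∨ ∃ h : q ∈ Δ.certWindow σ x, _) ↔ b = true
  rw [hq, Option.some.injEq]
  constructor
  · rintro (h | ⟨h, -⟩)
    · exact h
    · exact absurd hqdom (mem_certWindow.1 h).2
  · exact fun h => Or.inl h

/-- On the window the oracle of `u` reads `u`. [folklore] -/
theorem mem_certOracle_iff_of_mem {σ : CohenCondition} {x w : List Bool}
    (u : Fin (Δ.certWindow σ x).card → Bool) (hw : w ∈ Δ.certWindow σ x) :
    w ∈ Δ.certOracle σ x u ↔ u ((Δ.certWindow σ x).equivFin ⟨w, hw⟩) = true := by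
  have hval : σ.val w = none := by
    have := (mem_certWindow.1 hw).2
    rwa [mem_dom_iff, not_not] at this
  change (σ.val w = some true ∨ ∃ h : w ∈ Δ.certWindow σ x, _) ↔ _
  rw [hval]
  constructor
  · rintro (h | ⟨h, hu⟩)
    · exact absurd h (by simp)
    · exact hu
  · exact fun h => Or.inr ⟨hw, h⟩

/-- Off the window the oracle of `u` reads `σ` (true strings of `σ` only). [folklore] -/
theorem mem_certOracle_iff_of_not_mem {σ : CohenCondition} {x w : List Bool}
    (u : Fin (Δ.certWindow σ x).card → Bool) (hw : w ∉ Δ.certWindow σ x) :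
    w ∈ Δ.certOracle σ x u ↔ σ.val w = some true := by
  change (σ.val w = some true ∨ ∃ h : w ∈ Δ.certWindow σ x, _) ↔ _
  constructor
  · rintro (h | ⟨h, -⟩)
    · exact h
    · exact absurd h hw
  · exact fun h => Or.inl h

/-- The window point of the oracle of `u` is `u`. [folklore] -/
theorem certPoint_certOracle (σ : CohenCondition) (x : List Bool)
    (u : Fin (Δ.certWindow σ x).card → Bool) : Δ.certPoint σ x (Δ.certOracle σ x u) = u := by
  funext i
  unfold certPoint
  have hw := ((Δ.certWindow σ x).equivFin.symm i).2
  have key : ((Δ.certWindow σ x).equivFin.symm i).1 ∈ Δ.certOracle σ x u ↔ u i = true := by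
    rw [mem_certOracle_iff_of_mem u hw]
    simp
  rcases Bool.eq_false_or_eq_true (u i) with h | h
  · rw [h]
    exact (Set.mem_iff_boolIndicator _ _).1 (key.2 h)
  · rw [h]
    exact (Set.notMem_iff_boolIndicator _ _).1 fun hm => by simpa [h] using key.1 hm

/-! ### Locality: the language at `x` is the window function at the window point -/

/-- **Queries of well-formed descriptions have short tails**: every string of `Z` the promise at
`x` can read (`zQueries`) has length `< d(x)` ("the length of each oracle query is also bounded by
`nᵏ`"). [cite: FennerFortnowKurtzLi2003IC, §6.3 (p. 31) and Thm. 6.13 (proof)] -/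
theorem length_lt_certDeg_of_mem_zQueries (hwf : Δ.WellFormed) {Z : Language Bool} {x t : List Bool}
    (ht : t ∈ Δ.zQueries B Z x) : t.length < Δ.certDeg x := by
  unfold zQueries at ht
  rcases Finset.mem_union.1 ht with h | h
  · obtain ⟨y, -, hy⟩ := Finset.mem_biUnion.1 h
    obtain ⟨s, hs, rfl⟩ := Finset.mem_image.1 hy
    rw [List.mem_toFinset] at hs
    have hlen := (hwf.2.2.1 (Oracle.ofLanguage (oracleJoin B Z)) (boolPair x y.toList)).2 s hs
    have hpos : 0 < Δ.q₁.eval (boolPair x y.toList).length := by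
      have := Δ.M₁.length_queries_le (Oracle.ofLanguage (oracleJoin B Z))
        (Δ.q₁.eval (boolPair x y.toList).length) (boolPair x y.toList)
      exact lt_of_lt_of_le (List.length_pos_of_mem hs) this
    rw [Δ.eval_length_boolPair_eq_certFuel₁ x y] at hlen hpos
    have : s.tail.length + 1 ≤ Δ.certFuel₁ x := by
      rcases s with _ | ⟨b, w⟩
      · simp only [List.tail_nil, List.length_nil]; omega
      · simp only [List.tail_cons, List.length_cons] at hlen ⊢; omega
    exact lt_of_lt_of_le (Nat.lt_of_succ_le this) (le_max_left _ _)
  · obtain ⟨y, -, hy⟩ := Finset.mem_biUnion.1 h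
    obtain ⟨s, hs, rfl⟩ := Finset.mem_image.1 hy
    rw [List.mem_toFinset] at hs
    have hlen := (hwf.2.2.2 (Oracle.ofLanguage (oracleJoin B Z)) (boolPair x y.toList)).2 s hs
    have hpos : 0 < Δ.q₂.eval (boolPair x y.toList).length := by
      have := Δ.M₂.length_queries_le (Oracle.ofLanguage (oracleJoin B Z))
        (Δ.q₂.eval (boolPair x y.toList).length) (boolPair x y.toList)
      exact lt_of_lt_of_le (List.length_pos_of_mem hs) this
    rw [Δ.eval_length_boolPair_eq_certFuel₂ x y] at hlen hpos
    have : s.tail.length + 1 ≤ Δ.certFuel₂ x := by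
      rcases s with _ | ⟨b, w⟩
      · simp only [List.tail_nil, List.length_nil]; omega
      · simp only [List.tail_cons, List.length_cons] at hlen ⊢; omega
    exact lt_of_lt_of_le (Nat.lt_of_succ_le this) (le_max_right _ _)

/-- An oracle extending `σ` and the oracle of its window point agree on every short string.
[cite: FennerFortnowKurtzLi2003IC, Thm. 6.13 (proof, p. 32)] -/
theorem mem_certOracle_certPoint_iff {σ : CohenCondition} {Z : Language Bool} (hZ : σ.ExtendedBy Z)
    {x t : List Bool} (ht : t.length < Δ.certDeg x) :
    t ∈ Δ.certOracle σ x (Δ.certPoint σ x Z) ↔ t ∈ Z := by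
  by_cases htw : t ∈ Δ.certWindow σ x
  · rw [mem_certOracle_iff_of_mem _ htw]
    unfold certPoint
    rw [Equiv.symm_apply_apply]
    exact (Set.mem_iff_boolIndicator _ _).symm
  · have htdom : t ∈ σ.dom := by
      by_contra h
      exact htw (mem_certWindow.2 ⟨ht, h⟩)
    exact (extendedBy_certOracle σ x _).mem_iff_mem hZ htdom

/-- **Locality**: for a well-formed `Δ` and `Z` extending `σ`, `x ∈ lang B Z` iff the window
function of `x` is `1` at the window point of `Z` (the two gaps coincide, `gap_congr`: the
machines only read short strings of `Z`, on which `Z` and the oracle of its window point agree).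
[cite: FennerFortnowKurtzLi2003IC, Thm. 6.13 (proof, p. 32: "let y be induced by any oracle A")] -/
theorem gap_certOracle_certPoint (hwf : Δ.WellFormed) {σ : CohenCondition} {Z : Language Bool}
    (hZ : σ.ExtendedBy Z) (x : List Bool) :
    Δ.gap B (Δ.certOracle σ x (Δ.certPoint σ x Z)) x = Δ.gap B Z x :=
  Δ.gap_congr B fun _ ht => mem_certOracle_certPoint_iff hZ (length_lt_certDeg_of_mem_zQueries hwf ht)

/-- The language form of locality. [cite: FennerFortnowKurtzLi2003IC, Thm. 6.13 (proof, p. 32)] -/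
theorem mem_lang_iff_certFn (hwf : Δ.WellFormed) {σ : CohenCondition} {Z : Language Bool}
    (hZ : σ.ExtendedBy Z) (x : List Bool) :
    x ∈ Δ.lang B Z ↔ Δ.certFn B σ x (Δ.certPoint σ x Z) = true := by
  unfold certFn
  rw [← Set.mem_iff_boolIndicator]
  change 2 * (2 : ℤ) ^ Δ.p.eval x.length ≤ 3 * Δ.gap B Z x ↔
    2 * (2 : ℤ) ^ Δ.p.eval x.length ≤ 3 * Δ.gap B (Δ.certOracle σ x (Δ.certPoint σ x Z)) x
  rw [gap_certOracle_certPoint hwf hZ x]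

/-! ### The view of `B ⊕ Z` over the window, and the gap polynomial -/

/-- **The view** presenting the join `B ⊕ Z`, `Z` ranging over the oracles of window points: the
empty query and `0w` are constants (`0`, `[w ∈ B]`), `1w` is the variable of `w` if `w` is in the
window and the constant `σ(w)` (`0` if undecided) otherwise.
[cite: FennerFortnowKurtzLi2003IC, Lemma 6.12 (proof, p. 31: the variables y_w) and Thm. 6.13 (proof)] -/
def certView (Δ : AWPPDescr) (B : Language Bool) (σ : CohenCondition) (x : List Bool) :
    List Bool → Fin (Δ.certWindow σ x).card ⊕ Bool
  | [] => Sum.inr false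
  | false :: w => Sum.inr (B.boolIndicator w)
  | true :: w =>
    if h : w ∈ Δ.certWindow σ x then Sum.inl ((Δ.certWindow σ x).equivFin ⟨w, h⟩)
    else Sum.inr (({w | σ.val w = some true} : Set (List Bool)).boolIndicator w)

/-- Two bits agree when their truth conditions are equivalent. [folklore] -/
private theorem bool_eq_boolIndicator_of_iff {γ : Type} {b : Bool} {C : Set γ} {c : γ}
    (h : b = true ↔ c ∈ C) : b = C.boolIndicator c := by
  rcases Bool.eq_false_or_eq_true b with hb | hb
  · rw [hb]
    exact ((Set.mem_iff_boolIndicator _ _).1 (h.1 hb)).symm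
  · rw [hb]
    exact ((Set.notMem_iff_boolIndicator _ _).1 fun hc => Bool.false_ne_true (hb ▸ h.2 hc)).symm

/-- **The view presents the join**: at the window point `u` the viewed oracle is the language
oracle of `B ⊕ certOracle u`. [cite: FennerFortnowKurtzLi2003IC, Lemma 6.12 and Thm. 6.13 (proofs, pp. 31–32)] -/
theorem viewOracle_certView (σ : CohenCondition) (x : List Bool)
    (u : Fin (Δ.certWindow σ x).card → Bool) :
    OracleAlg.viewOracle (Δ.certView B σ x) u = Oracle.ofLanguage (oracleJoin B (Δ.certOracle σ x u)) := by
  funext s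
  change encodeBool (OracleAlg.viewBit (Δ.certView B σ x) u s) = encodeBool _
  congr 1
  unfold OracleAlg.viewBit
  rcases s with _ | ⟨b, w⟩
  · rw [show Δ.certView B σ x [] = Sum.inr false from rfl, Sum.elim_inr, id,
      (Set.notMem_iff_boolIndicator _ _).1 nil_not_mem_oracleJoin]
  · cases b
    · rw [show Δ.certView B σ x (false :: w) = Sum.inr (B.boolIndicator w) from rfl, Sum.elim_inr, id]
      exact boolIndicator_eq_of_iff (false_cons_mem_oracleJoin (A := B) (B := Δ.certOracle σ x u)).symm
    · by_cases hw : w ∈ Δ.certWindow σ x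
      · rw [show Δ.certView B σ x (true :: w) = Sum.inl ((Δ.certWindow σ x).equivFin ⟨w, hw⟩) by
          simp [certView, hw], Sum.elim_inl]
        exact bool_eq_boolIndicator_of_iff
          ((mem_certOracle_iff_of_mem u hw).symm.trans
            (true_cons_mem_oracleJoin (A := B) (B := Δ.certOracle σ x u)).symm)
      · rw [show Δ.certView B σ x (true :: w) =
            Sum.inr (({w | σ.val w = some true} : Set (List Bool)).boolIndicator w) by
          simp [certView, hw], Sum.elim_inr, id]
        exact boolIndicator_eq_of_iff
          ((mem_certOracle_iff_of_not_mem u hw).symm.trans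
            (true_cons_mem_oracleJoin (A := B) (B := Δ.certOracle σ x u)).symm)

/-- **The approximating polynomial** of the window function of `x`: the gap polynomial of the two
machines over the witnesses of `x` under the view, divided by `2^{p(|x|)}` ("define `p(y)` … as
`h(y)/2^{q(n)}`"). [cite: FennerFortnowKurtzLi2003IC, Thm. 6.13 (proof, p. 31)] -/
def certPoly (Δ : AWPPDescr) (B : Language Bool) (σ : CohenCondition) (x : List Bool) :
    MvPolynomial (Fin (Δ.certWindow σ x).card) ℝ :=
  MvPolynomial.C ((2 : ℝ) ^ Δ.p.eval x.length)⁻¹ *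
    OracleAlg.gapPoly Δ.M₁ Δ.M₂ (Δ.certView B σ x) (Δ.certFuel₁ x) (Δ.certFuel₂ x)
      (fun y : List.Vector Bool (Δ.r₁.eval x.length) => boolPair x y.toList)
      (fun y : List.Vector Bool (Δ.r₂.eval x.length) => boolPair x y.toList)

/-- **Degree bound** (Lemma 6.12): the approximating polynomial has total degree `≤ d(x)`.
[cite: FennerFortnowKurtzLi2003IC, Lemma 6.12 (p. 31)] -/
theorem totalDegree_certPoly_le (σ : CohenCondition) (x : List Bool) :
    (Δ.certPoly B σ x).totalDegree ≤ Δ.certDeg x := by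
  unfold certPoly
  refine (MvPolynomial.totalDegree_mul _ _).trans ?_
  rw [MvPolynomial.totalDegree_C, zero_add]
  exact OracleAlg.totalDegree_gapPoly_le _ _ _ _ _ _ _

/-- The first count at the oracle of `u`, read off the view. [cite: FennerFortnowKurtzLi2003IC, Lemma 6.12 (p. 31)] -/
theorem card_filter_run₁_eq_cnt₁ (σ : CohenCondition) (x : List Bool)
    (u : Fin (Δ.certWindow σ x).card → Bool) :
    ((univ.filter fun y : List.Vector Bool (Δ.r₁.eval x.length) =>
        Δ.M₁.run (OracleAlg.viewOracle (Δ.certView B σ x) u) (Δ.certFuel₁ x) (boolPair x y.toList) =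
          some true).card : ℝ) = Δ.cnt₁ B (Δ.certOracle σ x u) x := by
  classical
  unfold cnt₁ countWitnesses
  rw [viewOracle_certView]
  congr 2
  refine Finset.filter_congr fun y _ => ?_
  rw [← Δ.eval_length_boolPair_eq_certFuel₁ x y]
  rfl

/-- The second count at the oracle of `u`, read off the view. [cite: FennerFortnowKurtzLi2003IC, Lemma 6.12 (p. 31)] -/
theorem card_filter_run₂_eq_cnt₂ (σ : CohenCondition) (x : List Bool)
    (u : Fin (Δ.certWindow σ x).card → Bool) :
    ((univ.filter fun y : List.Vector Bool (Δ.r₂.eval x.length) =>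
        Δ.M₂.run (OracleAlg.viewOracle (Δ.certView B σ x) u) (Δ.certFuel₂ x) (boolPair x y.toList) =
          some true).card : ℝ) = Δ.cnt₂ B (Δ.certOracle σ x u) x := by
  classical
  unfold cnt₂ countWitnesses
  rw [viewOracle_certView]
  congr 2
  refine Finset.filter_congr fun y _ => ?_
  rw [← Δ.eval_length_boolPair_eq_certFuel₂ x y]
  rfl

/-- **The polynomial computes the normalized gap**: at the window point `u` it evaluates to
`gap(x)/2^{p(|x|)}` relative to `B ⊕ certOracle u`. [cite: FennerFortnowKurtzLi2003IC, Lemma 6.12 and Thm. 6.13 (proof, p. 31)] -/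
theorem eval_certPoly (σ : CohenCondition) (x : List Bool) (u : Fin (Δ.certWindow σ x).card → Bool) :
    MvPolynomial.eval (Multilinear.boolPt (R := ℝ) u) (Δ.certPoly B σ x) =
      (Δ.gap B (Δ.certOracle σ x u) x : ℝ) / (2 : ℝ) ^ Δ.p.eval x.length := by
  unfold certPoly
  rw [map_mul, MvPolynomial.eval_C, OracleAlg.eval_gapPoly, card_filter_run₁_eq_cnt₁,
    card_filter_run₂_eq_cnt₂, gap, Int.cast_sub, Int.cast_natCast, Int.cast_natCast]
  ring

/-! ### Thm. 6.13: block sensitivity and certificates of the window function -/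

/-- **The promise makes `certPoly` a `[0,1]`-valued `1/3`-approximant of `certFn`** for a
description categorical over `σ` (the oracle of every window point extends `σ`).
[cite: FennerFortnowKurtzLi2003IC, Thm. 6.13 (proof, p. 32: "|f(y) − p(y)| ≤ 1/3")] -/
theorem certPoly_approx {σ : CohenCondition} (hcat : Δ.Categorical B σ) (x : List Bool)
    (u : Fin (Δ.certWindow σ x).card → Bool) :
    (0 ≤ MvPolynomial.eval (Multilinear.boolPt (R := ℝ) u) (Δ.certPoly B σ x) ∧
      MvPolynomial.eval (Multilinear.boolPt (R := ℝ) u) (Δ.certPoly B σ x) ≤ 1) ∧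
    (Δ.certFn B σ x u = false →
      MvPolynomial.eval (Multilinear.boolPt (R := ℝ) u) (Δ.certPoly B σ x) ≤ 1 / 3) ∧
    (Δ.certFn B σ x u = true →
      2 / 3 ≤ MvPolynomial.eval (Multilinear.boolPt (R := ℝ) u) (Δ.certPoly B σ x)) := by
  rw [eval_certPoly]
  set g : ℤ := Δ.gap B (Δ.certOracle σ x u) x with hg
  set n : ℕ := Δ.p.eval x.length with hn
  have hprom : (2 * (2 : ℤ) ^ n ≤ 3 * g ∧ g ≤ (2 : ℤ) ^ n) ∨ (0 ≤ g ∧ 3 * g ≤ (2 : ℤ) ^ n) :=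
    hcat _ (extendedBy_certOracle σ x u) x
  have hfn : Δ.certFn B σ x u = true ↔ 2 * (2 : ℤ) ^ n ≤ 3 * g := by
    unfold certFn
    rw [← Set.mem_iff_boolIndicator]
    rfl
  have hpow : (0 : ℝ) < (2 : ℝ) ^ n := by positivity
  have hpowZ : (0 : ℤ) < (2 : ℤ) ^ n := by positivity
  -- casts of the promise
  have cast_le : ∀ {a b : ℤ}, a ≤ b → ((a : ℤ) : ℝ) ≤ ((b : ℤ) : ℝ) := fun h => by exact_mod_cast h
  refine ⟨⟨?_, ?_⟩, fun hf => ?_, fun hf => ?_⟩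
  · rw [le_div_iff₀ hpow, zero_mul]
    rcases hprom with ⟨h1, -⟩ | ⟨h1, -⟩
    · have : (0 : ℤ) ≤ g := by linarith
      exact_mod_cast this
    · exact_mod_cast h1
  · rw [div_le_iff₀ hpow, one_mul]
    rcases hprom with ⟨-, h2⟩ | ⟨h1, h2⟩
    · exact_mod_cast h2
    · have : g ≤ (2 : ℤ) ^ n := by linarith
      exact_mod_cast this
  · have hnot : ¬ 2 * (2 : ℤ) ^ n ≤ 3 * g := fun h => by
      rw [← hfn] at h
      rw [h] at hf
      exact Bool.noConfusion hf
    rcases hprom with ⟨h1, -⟩ | ⟨-, h2⟩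
    · exact absurd h1 hnot
    · rw [div_le_iff₀ hpow]
      have : (3 : ℝ) * (g : ℝ) ≤ (2 : ℝ) ^ n := by exact_mod_cast h2
      linarith
  · have h1 : 2 * (2 : ℤ) ^ n ≤ 3 * g := hfn.1 hf
    rw [le_div_iff₀ hpow]
    have : (2 : ℝ) * (2 : ℝ) ^ n ≤ 3 * (g : ℝ) := by exact_mod_cast h1
    linarith

/-- **Thm. 6.13, block-sensitivity form**: for a description categorical over `σ`, the window
function of every input `x` has block sensitivity at most `4 d(x)²` (Lemma 6.12 + Thm. 6.11).
This is the round bound `R ≥ bs(f)` under which the Standard Algorithm is correct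
(`StdAlg.decide_eq`). [cite: FennerFortnowKurtzLi2003IC, Thm. 6.13 (pp. 31–32)] -/
theorem blockSensitivity_certFn_le {σ : CohenCondition} (hcat : Δ.Categorical B σ) (x : List Bool) :
    blockSensitivity (Δ.certFn B σ x) ≤ 4 * Δ.certDeg x ^ 2 :=
  blockSensitivity_le_four_mul_sq_of_approx (Δ.certFn B σ x) (Δ.certPoly B σ x)
    (totalDegree_certPoly_le σ x) (fun u => (certPoly_approx hcat x u).1)
    (fun u => (certPoly_approx hcat x u).2.1) (fun u => (certPoly_approx hcat x u).2.2)

/-- **Thm. 6.13, certificate-complexity form**: `C(f) ≤ 16 d(x)⁴` for the window function of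
every input of a description categorical over `σ` ("the certificate complexity of `f` [is]
polynomial in `n`", with `c(d) = 16 d⁴`). [cite: FennerFortnowKurtzLi2003IC, Thm. 6.13 (pp. 31–32)] -/
theorem certificateComplexity_certFn_le {σ : CohenCondition} (hcat : Δ.Categorical B σ) (x : List Bool) :
    certificateComplexity (Δ.certFn B σ x) ≤ 16 * Δ.certDeg x ^ 4 :=
  certificateComplexity_le_of_approx (Δ.certFn B σ x) (Δ.certPoly B σ x)
    (totalDegree_certPoly_le σ x) (fun u => (certPoly_approx hcat x u).1)
    (fun u => (certPoly_approx hcat x u).2.1) (fun u => (certPoly_approx hcat x u).2.2)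

/-- **Small certificates at every window point**: a set of at most `16 d(x)⁴` window variables
fixing the value of the window function. [cite: FennerFortnowKurtzLi2003IC, Thm. 6.13 (p. 32: "a set S_y (of size at most c(nᵏ))")] -/
theorem exists_isCertificate_certFn {σ : CohenCondition} (hcat : Δ.Categorical B σ) (x : List Bool)
    (u : Fin (Δ.certWindow σ x).card → Bool) :
    ∃ S : Finset (Fin (Δ.certWindow σ x).card), IsCertificate (Δ.certFn B σ x) u S ∧
      S.card ≤ 16 * Δ.certDeg x ^ 4 :=
  exists_certificate_of_approx (Δ.certFn B σ x) (Δ.certPoly B σ x) (totalDegree_certPoly_le σ x)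
    (fun u => (certPoly_approx hcat x u).1) (fun u => (certPoly_approx hcat x u).2.1)
    (fun u => (certPoly_approx hcat x u).2.2) u

/-! ### Thm. 6.13 at the level of oracles: small finite conditions decide the language -/

/-- Window points of two oracles agree at a variable whose string they agree on. [folklore] -/
theorem certPoint_eq_of_iff {σ : CohenCondition} {x : List Bool} {Z Z' : Language Bool}
    {i : Fin (Δ.certWindow σ x).card}
    (h : ((Δ.certWindow σ x).equivFin.symm i).1 ∈ Z' ↔ ((Δ.certWindow σ x).equivFin.symm i).1 ∈ Z) :
    Δ.certPoint σ x Z' i = Δ.certPoint σ x Z i :=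
  boolIndicator_eq_of_iff h

/-- **"AWPP has polynomial certificate complexity" for descriptions, as printed** (Thm. 6.13 with
Def. 6.6/6.7): for a well-formed description categorical over `σ`, every oracle `Z` extending `σ`
and every input `x`, some finite condition `β` extended by `Z`, defined on at most `16 d(x)⁴`
strings of the window (so outside `dom σ` and of length `< d(x)`: of size `≤ 16 d(x)⁴ (1 + d(x))`
in the measure `Σ (1 + |w|)`), decides `x` for every oracle extending `σ` and `β`:
`x ∈ lang B Z' ↔ x ∈ lang B Z`. [cite: FennerFortnowKurtzLi2003IC, Thm. 6.13 (pp. 31–32) and Def. 6.7 (p. 27)] -/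
theorem exists_certificate_condition (hwf : Δ.WellFormed) {σ : CohenCondition}
    (hcat : Δ.Categorical B σ) {Z : Language Bool} (hZ : σ.ExtendedBy Z) (x : List Bool) :
    ∃ β : CohenCondition, β.ExtendedBy Z ∧ β.dom ⊆ ↑(Δ.certWindow σ x) ∧
      β.dom.ncard ≤ 16 * Δ.certDeg x ^ 4 ∧
      ∀ Z' : Language Bool, σ.ExtendedBy Z' → β.ExtendedBy Z' → (x ∈ Δ.lang B Z' ↔ x ∈ Δ.lang B Z) := by
  classical
  obtain ⟨S, hS, hcard⟩ := exists_isCertificate_certFn hcat x (Δ.certPoint σ x Z)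
  set s : Finset (List Bool) := S.image fun i => ((Δ.certWindow σ x).equivFin.symm i).1 with hs
  refine ⟨restrict Z s, extendedBy_restrict Z s, ?_, ?_, fun Z' hZ' hβ => ?_⟩
  · rw [dom_restrict]
    intro w hw
    obtain ⟨i, -, rfl⟩ := Finset.mem_image.1 (Finset.mem_coe.1 hw)
    exact ((Δ.certWindow σ x).equivFin.symm i).2
  · rw [dom_restrict, Set.ncard_coe_finset]
    exact Finset.card_image_le.trans hcard
  · rw [mem_lang_iff_certFn hwf hZ' x, mem_lang_iff_certFn hwf hZ x]
    have hagree : Δ.certFn B σ x (Δ.certPoint σ x Z') = Δ.certFn B σ x (Δ.certPoint σ x Z) := by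
      refine hS _ fun i hi => certPoint_eq_of_iff ?_
      exact BGS.mem_iff_mem_of_extendedBy_restrict hβ (Finset.mem_image_of_mem _ hi)
    rw [hagree]

/-- **Polynomial certificate complexity, uniform form**: one polynomial bounds, for every
condition `σ` over which the well-formed `Δ` is categorical, every `Z` extending `σ` and every `x`,
the number (`≤ c(|x|)`) and the lengths (`< c(|x|)`) of the strings of a deciding condition — "a
polynomial independent of `σ`". [cite: FennerFortnowKurtzLi2003IC, Thm. 6.13 (p. 32) and Def. 6.7 (p. 27, polynomial certificate complexity)] -/
theorem polynomialCertificateComplexity (hwf : Δ.WellFormed) :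
    ∃ c : Polynomial ℕ, ∀ (σ : CohenCondition), Δ.Categorical B σ →
      ∀ (Z : Language Bool), σ.ExtendedBy Z → ∀ x : List Bool,
        ∃ β : CohenCondition, β.ExtendedBy Z ∧ (∀ w ∈ β.dom, w ∉ σ.dom ∧ w.length < c.eval x.length) ∧
          β.dom.ncard ≤ c.eval x.length ∧
          ∀ Z' : Language Bool, σ.ExtendedBy Z' → β.ExtendedBy Z' →
            (x ∈ Δ.lang B Z' ↔ x ∈ Δ.lang B Z) := by
  refine ⟨16 * Δ.certDegPoly ^ 4 + Δ.certDegPoly, fun σ hcat Z hZ x => ?_⟩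
  obtain ⟨β, hβZ, hdom, hcard, hdec⟩ := exists_certificate_condition hwf hcat hZ x
  have hd := Δ.certDeg_le_eval_certDegPoly x
  have heval : (16 * Δ.certDegPoly ^ 4 + Δ.certDegPoly).eval x.length =
      16 * (Δ.certDegPoly.eval x.length) ^ 4 + Δ.certDegPoly.eval x.length := by
    simp [Polynomial.eval_add, Polynomial.eval_mul, Polynomial.eval_pow]
  refine ⟨β, hβZ, fun w hw => ?_, ?_, hdec⟩
  · have hw' := mem_certWindow.1 (Finset.mem_coe.1 (hdom hw))
    refine ⟨hw'.2, ?_⟩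
    rw [heval]
    exact lt_of_lt_of_le hw'.1 (hd.trans (Nat.le_add_left _ _))
  · rw [heval]
    calc β.dom.ncard ≤ 16 * Δ.certDeg x ^ 4 := hcard
      _ ≤ 16 * (Δ.certDegPoly.eval x.length) ^ 4 :=
        Nat.mul_le_mul_left _ (Nat.pow_le_pow_left hd 4)
      _ ≤ _ := Nat.le_add_right _ _

end AWPPDescr

end Literature.Barriers.QuantumAdvantage

end
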